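import Mathlib.Data.Nat.Factorial.Basic
import Mathlib.Data.Fintype.Pigeonhole
import Mathlib.Analysis.SpecialFunctions.Complex.Log
import Literature.NumberTheory.LFunctions.MoebiusAutomaticRootReduction
import HarnessLib

/-!
# Zero-stable roots in a power base and the final interface for Müllner's theorem (proved)

Everything in this file is PROVED. It supplies the last elementary piece of the reduction of
the named fact `Literature.NumberTheory.LFunctions.mullner_moebius_automatic` (C. Müllner,
*Automatic sequences fulfill the Sarnak conjecture*, Duke Math. J. 166 (2017), Thm. 1.2) to the
analytic estimate of the paper (Prop. 3.2 via Thm. 4.4): the existence, after the base change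
`k ↦ k^p` of Prop. 2.25 (with `p` a multiple of `|Q'|!`, an instance of the exponents `d(A) k₀(A)`
managed there), of ZERO-STABLE roots (`δ(M,0) = M`, `T(M,0) = id`) in the naturally induced
transducer of every final component of the power automaton — the states from which the literal
truncations of Def. 4.1 read padded blocks (`MoebiusAutomaticCarry.lean`) and from which the
reduction `isLittleO_moebiusSum_dfaoSeq_of_rootAPEstimate` (`MoebiusAutomaticRootReduction.lean`)
reads the digits of `n` without shift.

* `Function.iterate_factorial_idempotent` — for `f : σ → σ` on a finite type and `|σ|! ∣ p`,
  `p ≥ 1`: `f^[p] ∘ f^[p] = f^[p]` (every orbit is periodic beyond `|σ|` steps with a period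
  `≤ |σ|`, which divides `|σ|!`).
* `MinImage.next_idem_of_idempotent`, `MinImage.T_eq_one_of_wordAct_eq_self` — a word acting
  idempotently makes `δ(M, w)` a `w`-stable state with trivial output.
* `exists_zeroStable_root_pow` — for `|σ|! ∣ p`, `p ≥ 1`, EVERY final component of the
  digit-restricted `p`-th power automaton `digitRestrict (k^p) (powδ k p δ)` has a zero-stable
  state of its transducer (the letter `0` of base `k^p` acts as `(q ↦ δ(q,0))^[p]`).
* `mullner_moebius_automatic_of_rootAPEstimate_zeroStable` — **the final interface**: Müllner's
  theorem follows once, for every `k ≥ 2` and every finite base-`k` DFAO with `δ(q₀,0) = q₀`, some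
  `p ≥ 1` with `|σ|! ∣ p` is such that every zero-stable root `M` of every final component of the
  power automaton satisfies `RootAPEstimate (k^p) _ M`, i.e.
  `∑_{n<x, n≡c (q), T(M,(n)_{k^p}) = π} μ(n) = o(x)` for all `π, q, c` — Prop. 3.2 of the paper
  in its cleanest form (structured part: `μ` in progressions, Lemma 4.11; uniform part: Thm. 4.4
  with the carry property `MinImage.hasCarryProperty_T` and the Fourier property Thm. 4.5).

## References
* C. Müllner, Duke Math. J. 166 (2017) = arXiv:1602.03042: Prop. 2.25, Cor. 2.26, §3.1,
  Prop. 3.2/3.3. [Mullner2017]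
-/

noncomputable section

open Finset Filter Asymptotics
open scoped ArithmeticFunction.Moebius

namespace Literature.NumberTheory.LFunctions

/-! ## Iterates on a finite type -/

/-- **`f^[p]` is idempotent when `|σ|! ∣ p ≥ 1`**: the orbit of `x` repeats within `|σ|` steps
(pigeonhole), with a period `c ≤ |σ|`, `c ∣ |σ|! ∣ p`, and `p ≥ |σ|` lies beyond the pre-period.
[folklore] -/
theorem Function.iterate_factorial_idempotent {σ : Type*} [Fintype σ] (f : σ → σ) {p : ℕ}
    (hp : (Fintype.card σ).factorial ∣ p) (hp0 : 0 < p) (x : σ) : f^[p] (f^[p] x) = f^[p] x := by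
  classical
  set m := Fintype.card σ with hm
  -- pigeonhole on `i ↦ f^[i] x`, `i ≤ m`
  obtain ⟨i, j, hij, heq⟩ : ∃ i j : Fin (m + 1), i ≠ j ∧ f^[i] x = f^[j] x :=
    Fintype.exists_ne_map_eq_of_card_lt (fun i : Fin (m + 1) => f^[i] x) (by simp [hm])
  wlog hlt : (i : ℕ) < j generalizing i j
  · exact this j i hij.symm heq.symm
      (lt_of_le_of_ne (not_lt.1 hlt) fun h => hij (Fin.ext h).symm)
  set c := (j : ℕ) - i with hc
  have hcpos : 0 < c := by omega
  have hcm : c ≤ m := by have := j.2; omega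
  -- periodicity beyond `i`
  have hper : ∀ n, (i : ℕ) ≤ n → ∀ t, f^[n + t * c] x = f^[n] x := by
    intro n hn t
    induction t with
    | zero => simp
    | succ t ih =>
      have hle : (i : ℕ) ≤ n + t * c := hn.trans (Nat.le_add_right _ _)
      have h1 : n + (t + 1) * c = (n + t * c - i) + j := by
        rw [Nat.succ_mul]
        have hcj : c + i = j := by rw [hc]; omega
        omega
      rw [h1, Function.iterate_add_apply, ← heq, ← Function.iterate_add_apply,
        show n + t * c - i + i = n + t * c by omega, ih]
  -- `p ≥ i` and `c ∣ p`
  have hmp : m ≤ p := (Nat.self_le_factorial m).trans (Nat.le_of_dvd hp0 hp)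
  have hip : (i : ℕ) ≤ p := by have := i.2; omega
  have hcp : c ∣ p := (Nat.dvd_factorial hcpos hcm).trans hp
  obtain ⟨t, ht⟩ := hcp
  calc f^[p] (f^[p] x) = f^[p + t * c] x := by rw [← Function.iterate_add_apply, ht, mul_comm]
    _ = f^[p] x := hper p hip t

/-! ## Idempotent words in the transducer -/

namespace MinImage

variable {σ : Type*} [Fintype σ] [DecidableEq σ] {δ : σ → ℕ → σ}

/-- If `w` acts as the identity on `M` then `T(M, w) = id`. [folklore] -/
theorem T_eq_one_of_wordAct_eq_self (M : MinImage δ) (w : List ℕ)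
    (hfix : ∀ x ∈ M.1, wordAct δ w x = x) : M.T w = 1 := by
  have h : M.next w = M := Subtype.ext (by
    rw [coe_next, image_congr (g := id) (fun x hx => hfix x hx), image_id])
  ext i
  obtain ⟨x, rfl⟩ : ∃ x, M.enum x = i := M.enum.surjective i
  rw [T_apply_enum, Equiv.Perm.one_apply]
  have e1 : M.actEquiv w x = ⟨wordAct δ w x, (M.actEquiv w x).2⟩ := rfl
  have hx : wordAct δ w x ∈ M.1 := by rw [hfix x x.2]; exact x.2
  rw [e1, enum_congr h (wordAct δ w x) (M.actEquiv w x).2 hx]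
  have hsub : (⟨wordAct δ w x, hx⟩ : ↥M.1) = x := Subtype.ext (hfix x x.2)
  rw [hsub]

/-- **An idempotently acting word yields a stable state with trivial output**: if
`δ(δ(q,w),w) = δ(q,w)` for all states `q` then `M' = δ(M, w)` has `δ(M', w) = M'` and
`T(M', w) = id`. [folklore] -/
theorem next_idem_of_idempotent {w : List ℕ}
    (hidem : ∀ q, wordAct δ w (wordAct δ w q) = wordAct δ w q) (M : MinImage δ) : (M.next w).next w = M.next w ∧ (M.next w).T w = 1 := by
  have hfix : ∀ x ∈ (M.next w).1, wordAct δ w x = x := by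
    intro x hx
    rw [coe_next, mem_image] at hx
    obtain ⟨y, -, rfl⟩ := hx
    exact hidem y
  refine ⟨Subtype.ext ?_, T_eq_one_of_wordAct_eq_self _ w hfix⟩
  rw [coe_next, image_congr (g := id) (fun x hx => hfix x hx), image_id]

end MinImage

/-! ## The letter `0` of the power base -/

/-- Reading `p` zeros is the `p`-th iterate of the letter `0`. [folklore] -/
theorem wordAct_replicate_zero {σ : Type*} (δ : σ → ℕ → σ) (p : ℕ) (q : σ) :
    wordAct δ (List.replicate p 0) q = (fun q => δ q 0)^[p] q := by
  induction p generalizing q with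
  | zero => rfl
  | succ p ih =>
    rw [List.replicate_succ, show (0 :: List.replicate p 0) = [0] ++ List.replicate p 0 from rfl,
      wordAct_append, Function.iterate_succ_apply]
    exact ih _

/-- The padded block of `0` is `0^p`. [folklore] -/
theorem msbBlock_zero (k p : ℕ) : msbBlock k p 0 = List.replicate p 0 := by
  rw [msbBlock, Nat.digitsAppend, Nat.digits_zero, List.nil_append, List.length_nil,
    Nat.sub_zero, List.reverse_replicate]

/-- **The letter `0` of base `k^p` acts on the digit-restricted power automaton as
`(q ↦ δ(q,0))^[p]`.** [cite: Mullner2017, Prop. 2.25 (proof)] -/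
theorem digitRestrict_powδ_zero {σ : Type*} {k : ℕ} (hk : 1 ≤ k) (p : ℕ) (δ : σ → ℕ → σ)
    (q : σ) : digitRestrict (k ^ p) (powδ k p δ) q 0 = (fun q => δ q 0)^[p] q := by
  rw [digitRestrict_of_lt _ _ (pow_pos hk p), powδ, msbBlock_zero, wordAct_replicate_zero]

/-- **Zero-stable roots exist in every final component of the power automaton** when
`|σ|! ∣ p`, `p ≥ 1`: the letter `0` of base `k^p` acts idempotently, so from any state `M''` of
the component's transducer, `M = δ(M'', 0)` is zero-stable. [cite: Mullner2017, Prop. 2.25 / Cor. 2.26] -/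
theorem exists_zeroStable_root_pow {σ : Type} [Fintype σ] [DecidableEq σ] {k p : ℕ} (hk : 1 ≤ k)
    (δ : σ → ℕ → σ) (hp : (Fintype.card σ).factorial ∣ p) (hp0 : 0 < p) :
    ∀ q ∈ finalStates (digitRestrict (k ^ p) (powδ k p δ)),
      ∃ Mr : MinImage (restrictδ (digitRestrict (k ^ p) (powδ k p δ))
        (reach (digitRestrict (k ^ p) (powδ k p δ)) q)
        (reach_closed (digitRestrict (k ^ p) (powδ k p δ)) q)),
        Mr.next [0] = Mr ∧ Mr.T [0] = 1 := by
  intro q _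
  set Δ := digitRestrict (k ^ p) (powδ k p δ) with hΔ
  set ΔC := restrictδ Δ (reach Δ q) (reach_closed Δ q) with hΔC
  have hzero : ∀ y : σ, Δ y 0 = (fun q => δ q 0)^[p] y := fun y =>
    digitRestrict_powδ_zero hk p δ y
  have hidem : ∀ x : ↥(reach Δ q), wordAct ΔC [0] (wordAct ΔC [0] x) = wordAct ΔC [0] x := by
    intro x
    apply Subtype.ext
    rw [coe_wordAct_restrictδ, coe_wordAct_restrictδ]
    show Δ (Δ x 0) 0 = Δ x 0
    rw [hzero (Δ x 0), hzero x]
    exact Function.iterate_factorial_idempotent (fun q => δ q 0) hp hp0 _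
  obtain ⟨h1, h2⟩ := MinImage.next_idem_of_idempotent (w := [0]) hidem (transducerBase ΔC)
  exact ⟨(transducerBase ΔC).next [0], h1, h2⟩

/-! ## Assembling the root estimate from a structured and a uniform part -/

section Split

variable {σ' : Type*} [Fintype σ'] [DecidableEq σ']

/-- The AP form for a scalar observable `φ` of the transducer output (a property, NOT asserted):
for all `q ≥ 1`, `c`, `ε > 0`, eventually `|∑_{n<x, n≡c (q)} φ(T(M,(n)_k)) μ(n)| ≤ εx`. For
`φ = 1_{π}` this is `RootAPEstimate` (`rootAPEstimate_of_forall_fun`). [cite: Mullner2017, §4.3] -/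
def RootAPEstimateFun (k : ℕ) (δ' : σ' → ℕ → σ') (M : MinImage δ')
    (φ : Equiv.Perm (Fin (minRank δ')) → ℂ) : Prop :=
  ∀ (q : ℕ), 0 < q → ∀ (c : ℕ) (ε : ℝ), 0 < ε → ∃ x₀ : ℕ, ∀ x : ℕ, x₀ ≤ x →
    ‖∑ n ∈ (range x).filter (fun n => n % q = c),
      φ (M.T ((Nat.digits k n).reverse)) * (μ n : ℂ)‖ ≤ ε * x

/-- The exponential-sum (`θ`-uniform) form for a scalar observable `φ` (a property, NOT
asserted): for `ε > 0`, eventually, for ALL `θ ∈ ℝ`,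
`|∑_{n<x} φ(T(M,(n)_k)) e(θn) μ(n)| ≤ εx` — the shape of the conclusion of Müllner's Thm. 4.4
for `f(n) = D(T(M,(n)_k))` ("for any `θ ∈ ℝ` … `‖∑_{n ≤ x} μ(n) f(n) e(θn)‖ ≪ …`").
[cite: Mullner2017, Thm. 4.4] -/
def RootExpSumEstimate (k : ℕ) (δ' : σ' → ℕ → σ') (M : MinImage δ')
    (φ : Equiv.Perm (Fin (minRank δ')) → ℂ) : Prop :=
  ∀ ε : ℝ, 0 < ε → ∃ x₀ : ℕ, ∀ x : ℕ, x₀ ≤ x → ∀ θ : ℝ,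
    ‖∑ n ∈ range x, φ (M.T ((Nat.digits k n).reverse)) *
      Complex.exp (2 * Real.pi * Complex.I * (θ * n)) * (μ n : ℂ)‖ ≤ ε * x

/-- The AP form is additive in the observable. [folklore] -/
theorem RootAPEstimateFun.add {k : ℕ} {δ' : σ' → ℕ → σ'} {M : MinImage δ'}
    {φ₁ φ₂ : Equiv.Perm (Fin (minRank δ')) → ℂ} (h₁ : RootAPEstimateFun k δ' M φ₁)
    (h₂ : RootAPEstimateFun k δ' M φ₂) : RootAPEstimateFun k δ' M (fun g => φ₁ g + φ₂ g) := by
  intro q hq c ε hε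
  obtain ⟨x₁, hx₁⟩ := h₁ q hq c (ε / 2) (half_pos hε)
  obtain ⟨x₂, hx₂⟩ := h₂ q hq c (ε / 2) (half_pos hε)
  refine ⟨max x₁ x₂, fun x hx => ?_⟩
  have e : ∑ n ∈ (range x).filter (fun n => n % q = c),
      (φ₁ (M.T ((Nat.digits k n).reverse)) + φ₂ (M.T ((Nat.digits k n).reverse))) * (μ n : ℂ) =
      ∑ n ∈ (range x).filter (fun n => n % q = c), φ₁ (M.T ((Nat.digits k n).reverse)) * (μ n : ℂ) +
      ∑ n ∈ (range x).filter (fun n => n % q = c), φ₂ (M.T ((Nat.digits k n).reverse)) * (μ n : ℂ) := by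
    rw [← sum_add_distrib]
    exact sum_congr rfl fun n _ => add_mul _ _ _
  rw [e]
  calc _ ≤ ‖∑ n ∈ (range x).filter (fun n => n % q = c), φ₁ (M.T ((Nat.digits k n).reverse)) * (μ n : ℂ)‖
        + ‖∑ n ∈ (range x).filter (fun n => n % q = c), φ₂ (M.T ((Nat.digits k n).reverse)) * (μ n : ℂ)‖ :=
        norm_add_le _ _
    _ ≤ ε / 2 * x + ε / 2 * x :=
        add_le_add (hx₁ x ((le_max_left _ _).trans hx)) (hx₂ x ((le_max_right _ _).trans hx))
    _ = ε * x := by ring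

/-- **Orthogonality of the additive characters mod `q`**: for an integer `m`,
`∑_{h<q} e(hm/q) = q · [q ∣ m]`. [folklore] -/
theorem sum_range_exp_two_pi_mul_int_div {q : ℕ} (hq : 0 < q) (m : ℤ) :
    ∑ h ∈ range q, Complex.exp (2 * Real.pi * Complex.I * (h * m / q)) =
      if (q : ℤ) ∣ m then (q : ℂ) else 0 := by
  set w : ℂ := Complex.exp (2 * Real.pi * Complex.I * (m / q)) with hw
  have hqC : (q : ℂ) ≠ 0 := by exact_mod_cast hq.ne'
  have hterm : ∀ h : ℕ, Complex.exp (2 * Real.pi * Complex.I * (h * m / q)) = w ^ h := by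
    intro h
    rw [hw, ← Complex.exp_nat_mul]
    congr 1
    ring
  simp_rw [hterm]
  have hw1 : w = 1 ↔ (q : ℤ) ∣ m := by
    rw [hw, Complex.exp_eq_one_iff]
    constructor
    · rintro ⟨n, hn⟩
      refine ⟨n, ?_⟩
      have h2πI : (2 * Real.pi * Complex.I : ℂ) ≠ 0 := by
        simp [Real.pi_ne_zero, Complex.I_ne_zero]
      have h1 : ((m : ℂ) / q) * (2 * Real.pi * Complex.I) = n * (2 * Real.pi * Complex.I) := by
        rw [mul_comm]; exact hn
      have h2 : (m : ℂ) / q = n := mul_right_cancel₀ h2πI h1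
      have h3 : (m : ℂ) = (q : ℂ) * n := by rw [← h2]; field_simp
      exact_mod_cast h3
    · rintro ⟨n, rfl⟩
      refine ⟨n, ?_⟩
      push_cast
      field_simp
  by_cases hdvd : (q : ℤ) ∣ m
  · rw [if_pos hdvd, hw1.2 hdvd]
    simp
  · rw [if_neg hdvd]
    have hne : w ≠ 1 := fun h => hdvd (hw1.1 h)
    have hwq : w ^ q = 1 := by
      rw [hw, ← Complex.exp_nat_mul]
      have : (q : ℂ) * (2 * Real.pi * Complex.I * (m / q)) = m * (2 * Real.pi * Complex.I) := by
        field_simp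
      rw [this]
      exact Complex.exp_int_mul_two_pi_mul_I m
    rw [geom_sum_eq hne, hwq, sub_self, zero_div]

/-- **A residue class as an average of additive characters** (`c < q`):
`[n ≡ c (q)] = q⁻¹ ∑_{h<q} e(h(n − c)/q)`. [folklore] -/
theorem ite_mod_eq_sum_exp {q c : ℕ} (hq : 0 < q) (hc : c < q) (n : ℕ) :
    (if n % q = c then (1 : ℂ) else 0) =
      (q : ℂ)⁻¹ * ∑ h ∈ range q, Complex.exp (2 * Real.pi * Complex.I * (h * ((n : ℤ) - c) / q)) := by
  have hqC : (q : ℂ) ≠ 0 := by exact_mod_cast hq.ne'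
  have key := sum_range_exp_two_pi_mul_int_div hq ((n : ℤ) - c)
  push_cast at key ⊢
  rw [key]
  have hiff : n % q = c ↔ (q : ℤ) ∣ (n : ℤ) - c := by
    rw [← Nat.modEq_iff_dvd, Nat.ModEq, Nat.mod_eq_of_lt hc]
    exact ⟨fun h => h.symm, fun h => h.symm⟩
  by_cases h : n % q = c
  · rw [if_pos h, if_pos (hiff.1 h), inv_mul_cancel₀ hqC]
  · rw [if_neg h, if_neg (fun h' => h (hiff.2 h')), mul_zero]

/-- The character `e(-hc/q)` has norm one. [folklore] -/
theorem norm_exp_neg_char (h c q : ℕ) :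
    ‖Complex.exp (2 * Real.pi * Complex.I * (-(h * (c : ℂ) / q)))‖ = 1 := by
  have : (2 * Real.pi * Complex.I * (-(h * (c : ℂ) / q))) =
      ((-(2 * Real.pi * (h * c / q)) : ℝ) : ℂ) * Complex.I := by push_cast; ring
  rw [this, Complex.norm_exp_ofReal_mul_I]

/-- Pointwise expansion of a residue-class cut-off into additive characters, in the shape
`e(-hc/q) · (e((h/q) n) · z)`. [folklore] -/
theorem ite_mod_mul_eq_sum_exp {q c : ℕ} (hq : 0 < q) (hc : c < q) (n : ℕ) (z : ℂ) :
    (if n % q = c then z else 0) = (q : ℂ)⁻¹ * ∑ h ∈ range q,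
      Complex.exp (2 * Real.pi * Complex.I * (-(h * (c : ℂ) / q))) *
        (Complex.exp (2 * Real.pi * Complex.I * ((h : ℝ) / q * n)) * z) := by
  have e1 : (if n % q = c then z else 0) = (if n % q = c then (1 : ℂ) else 0) * z := by
    split_ifs <;> simp
  rw [e1, ite_mod_eq_sum_exp hq hc n, mul_assoc, sum_mul]
  congr 1
  refine sum_congr rfl fun h _ => ?_
  rw [← mul_assoc, ← Complex.exp_add]
  congr 2
  push_cast
  ring

/-- **The `θ`-uniform form implies the AP form** (expand the residue class into additive
characters `e(hn/q)`, `h < q`, and use the bound at `θ = h/q`). [cite: Mullner2017, §4.3] -/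
theorem RootExpSumEstimate.apEstimateFun {k : ℕ} {δ' : σ' → ℕ → σ'} {M : MinImage δ'}
    {φ : Equiv.Perm (Fin (minRank δ')) → ℂ} (h : RootExpSumEstimate k δ' M φ) :
    RootAPEstimateFun k δ' M φ := by
  intro q hq c ε hε
  obtain ⟨x₀, hx₀⟩ := h ε hε
  refine ⟨x₀, fun x hx => ?_⟩
  rcases le_or_gt q c with hcq | hcq
  · have : ((range x).filter fun n => n % q = c) = ∅ :=
      filter_eq_empty_iff.2 fun n _ hn => absurd hn ((Nat.mod_lt n hq).trans_le hcq).ne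
    rw [this, sum_empty, norm_zero]; positivity
  have hqR : (0 : ℝ) < q := by exact_mod_cast hq
  -- expand the indicator into additive characters
  have hexp : ∑ n ∈ (range x).filter (fun n => n % q = c),
      φ (M.T ((Nat.digits k n).reverse)) * (μ n : ℂ) =
      (q : ℂ)⁻¹ * ∑ h ∈ range q, Complex.exp (2 * Real.pi * Complex.I * (-(h * (c : ℂ) / q))) *
        ∑ n ∈ range x, φ (M.T ((Nat.digits k n).reverse)) *
          Complex.exp (2 * Real.pi * Complex.I * (((h : ℝ) / q : ℝ) * n)) * (μ n : ℂ) := by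
    rw [sum_filter, sum_congr rfl fun n _ =>
      ite_mod_mul_eq_sum_exp hq hcq n (φ (M.T ((Nat.digits k n).reverse)) * (μ n : ℂ)),
      ← mul_sum, sum_comm]
    congr 1
    refine sum_congr rfl fun h _ => ?_
    rw [mul_sum]
    refine sum_congr rfl fun n _ => ?_
    push_cast
    ring
  rw [hexp, norm_mul, norm_inv, Complex.norm_natCast]
  calc (q : ℝ)⁻¹ * ‖∑ h ∈ range q, Complex.exp (2 * Real.pi * Complex.I * (-(h * (c : ℂ) / q))) *
        ∑ n ∈ range x, φ (M.T ((Nat.digits k n).reverse)) *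
          Complex.exp (2 * Real.pi * Complex.I * (((h : ℝ) / q : ℝ) * n)) * (μ n : ℂ)‖
      ≤ (q : ℝ)⁻¹ * ∑ h ∈ range q, ‖Complex.exp (2 * Real.pi * Complex.I * (-(h * (c : ℂ) / q))) *
        ∑ n ∈ range x, φ (M.T ((Nat.digits k n).reverse)) *
          Complex.exp (2 * Real.pi * Complex.I * (((h : ℝ) / q : ℝ) * n)) * (μ n : ℂ)‖ := by
        gcongr; exact norm_sum_le _ _
    _ ≤ (q : ℝ)⁻¹ * ∑ _h ∈ range q, ε * x := by
        gcongr with h _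
        rw [norm_mul, norm_exp_neg_char, one_mul]
        exact hx₀ x hx ((h : ℝ) / q)
    _ = ε * x := by rw [sum_const, card_range, nsmul_eq_mul]; field_simp

/-- `RootAPEstimate` is the AP form for the indicators of the outputs. [folklore] -/
theorem rootAPEstimate_of_forall_fun {k : ℕ} {δ' : σ' → ℕ → σ'} {M : MinImage δ'}
    (h : ∀ π : Equiv.Perm (Fin (minRank δ')),
      RootAPEstimateFun k δ' M (fun g => if g = π then 1 else 0)) : RootAPEstimate k δ' M := by
  intro π q hq c ε hε
  obtain ⟨x₀, hx₀⟩ := h π q hq c ε hε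
  refine ⟨x₀, fun x hx => ?_⟩
  have e : ∑ n ∈ (range x).filter (fun n => n % q = c ∧ M.T ((Nat.digits k n).reverse) = π),
      (μ n : ℂ) = ∑ n ∈ (range x).filter (fun n => n % q = c),
        (if M.T ((Nat.digits k n).reverse) = π then (1 : ℂ) else 0) * (μ n : ℂ) := by
    rw [← filter_filter, sum_filter]
    refine sum_congr rfl fun n _ => ?_
    split_ifs <;> simp
  rw [e]
  exact hx₀ x hx

/-- **Splitting principle** (Müllner §4.3: the representations `D_ℓ` are treated through `μ` in
progressions, Lemma 4.11, the others through Thm. 4.4 uniformly in `θ`): if every output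
indicator `1_π` splits as `φ₁ + φ₂` on the range of outputs with `φ₁` satisfying the AP form and
`φ₂` the `θ`-uniform form, then `RootAPEstimate` holds. [cite: Mullner2017, §4.3] -/
theorem rootAPEstimate_of_split {k : ℕ} {δ' : σ' → ℕ → σ'} {M : MinImage δ'}
    (h : ∀ π : Equiv.Perm (Fin (minRank δ')), ∃ φ₁ φ₂ : Equiv.Perm (Fin (minRank δ')) → ℂ,
      (∀ g, (if g = π then (1 : ℂ) else 0) = φ₁ g + φ₂ g) ∧
        RootAPEstimateFun k δ' M φ₁ ∧ RootExpSumEstimate k δ' M φ₂) :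
    RootAPEstimate k δ' M := by
  refine rootAPEstimate_of_forall_fun fun π => ?_
  obtain ⟨φ₁, φ₂, hsplit, h₁, h₂⟩ := h π
  have := h₁.add h₂.apEstimateFun
  rw [show (fun g => if g = π then (1 : ℂ) else 0) = fun g => φ₁ g + φ₂ g from funext hsplit]
  exact this

end Split

/-! ## The final interface -/

/-- **Müllner's Thm. 1.2 (case `ξ = a`) from Prop. 3.2 at zero-stable roots of a power base.**
`mullner_moebius_automatic` holds provided: for every `k ≥ 2` and every finite base-`k` DFAO
`(σ, δ, q₀)` with `δ(q₀, 0) = q₀` there is `p ≥ 1` with `|σ|! ∣ p` such that, in the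
digit-restricted `p`-th power automaton (base `k^p`), every ZERO-STABLE state `M` of the
transducer of every final component satisfies `RootAPEstimate (k^p) _ M` — for all outputs `π`,
moduli `q ≥ 1` and residues `c`, `∑_{n<x, n≡c (q), T(M,(n)_{k^p}) = π} μ(n) = o(x)`. (Zero-stable
roots exist by `exists_zeroStable_root_pow`; the reduction is
`mullner_moebius_automatic_of_rootAPEstimate_pow`.) [cite: Mullner2017, Prop. 3.3 with Prop. 3.2, Prop. 2.25] -/
theorem mullner_moebius_automatic_of_rootAPEstimate_zeroStable
    (H : ∀ (k : ℕ), 2 ≤ k → ∀ (σ : Type) [Fintype σ] [DecidableEq σ] (δ : σ → ℕ → σ) (q₀ : σ),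
      δ q₀ 0 = q₀ → ∃ p : ℕ, 0 < p ∧ (Fintype.card σ).factorial ∣ p ∧
        ∀ q ∈ finalStates (digitRestrict (k ^ p) (powδ k p δ)),
          ∀ Mr : MinImage (restrictδ (digitRestrict (k ^ p) (powδ k p δ))
            (reach (digitRestrict (k ^ p) (powδ k p δ)) q)
            (reach_closed (digitRestrict (k ^ p) (powδ k p δ)) q)),
            Mr.next [0] = Mr → Mr.T [0] = 1 →
              RootAPEstimate (k ^ p) (restrictδ (digitRestrict (k ^ p) (powδ k p δ))
                (reach (digitRestrict (k ^ p) (powδ k p δ)) q)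
                (reach_closed (digitRestrict (k ^ p) (powδ k p δ)) q)) Mr) :
    mullner_moebius_automatic := by
  refine mullner_moebius_automatic_of_rootAPEstimate_pow fun k hk σ _ _ δ q₀ h0 => ?_
  obtain ⟨p, hp0, hpdvd, Hp⟩ := H k hk σ δ q₀ h0
  refine ⟨p, hp0, fun q hq => ?_⟩
  obtain ⟨Mr, hz0, hz1⟩ := exists_zeroStable_root_pow (by omega : 1 ≤ k) δ hpdvd hp0 q hq
  exact ⟨Mr, hz0, hz1, Hp q hq Mr hz0 hz1⟩

end Literature.NumberTheory.LFunctions
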